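import Mathlib
import Literature.Analysis.FluidPDE.Tao2016AveragedNS.ShiftSetCascadeFlows
import Summits.NavierStokesRegularity.NavierStokesRegularity.Theorems.TaoLadderRungTwoFlatCertificateGlueMeshOn
import HarnessLib

/-!
# Certificate glue on a shift set `𝕊`, X-d: ADMISSIBLE SECTION FUNCTIONALS — any continuous function of finitely
  many window coordinates is continuous along window runs (the hypothesis `hsec` of glue X / X-b / X-c / XII-b /
  XIII-b) (helper for items stmt-NavierStokesRegularity-22987 and stmt-24295; cell harvest/h2-tao-ladder, p1 g14;
  answers theory-1 g21 A3: the polynomial «energy half-transfer» section is admissible)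

`continuousOn_sec_of_continuous`: if `sec y = F (fun c => y (idx c).1 (idx c).2)` for a continuous
`F : (Fin N → ℝ) → ℝ` and finitely many WINDOW indices `idx c ∈ Fin m × [-Kb, Ka]`, then `u ↦ sec (slice S u)` is
continuous on `[0, s]` along every window run `S` (window coordinates of a run are continuous). Polynomials, absolute
values, energies of window shells are such `F`.

HONEST FRAMING: bookkeeping about MODEL-lattice window runs; nothing certified, nothing about the Navier–Stokes equations.
-/

noncomputable section

-- the sub-problem namespace repeats the summit name by design (D-0017)
set_option linter.dupNamespace false

namespace Summit.NavierStokesRegularity.NavierStokesRegularity.Theorems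

open Set Filter Topology Literature.Analysis.FluidPDE Literature.Analysis.FluidPDE.TaoCascade

namespace CertificateGlueOn

variable {m : ℕ} {𝕊 : Finset (ℤ × ℤ × ℤ)} {ε₀ : ℝ} {α : Fin m → Fin m → Fin m → ℤ × ℤ × ℤ → ℝ} {Kb Ka : ℤ}
  {Eb Et : ℝ}

/-- **Continuous functions of finitely many window coordinates are admissible section functionals.**
[cite: Tao2016AveragedNS, §6.4 Prop. 6.5 (the readout functional); cell certificate format, section functionals] -/
theorem continuousOn_sec_of_continuous {N : ℕ} {F : (Fin N → ℝ) → ℝ} (hF : Continuous F)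
    {idx : Fin N → Fin m × ℤ} (hidx : ∀ c, -Kb ≤ (idx c).2 ∧ (idx c).2 ≤ Ka)
    {sec : (Fin m → ℤ → ℝ) → ℝ} (hsec : ∀ y, sec y = F (fun c => y (idx c).1 (idx c).2))
    {s : ℝ} {S : Fin m → ℤ → ℝ → ℝ} (hrun : WindowRun 𝕊 ε₀ α Kb Ka Eb Et s S) :
    ContinuousOn (fun u => sec (slice S u)) (Icc 0 s) := by
  have hcoord : ContinuousOn (fun u => fun c : Fin N => S (idx c).1 (idx c).2 u) (Icc 0 s) :=
    continuousOn_pi.2 fun c => hrun.continuousOn (idx c).1 (hidx c).1 (hidx c).2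
  have := hF.comp_continuousOn hcoord
  refine this.congr fun u _ => ?_
  simp only [Function.comp_apply, hsec, slice_apply]

/-- Example: the ENERGY OF A SET OF WINDOW SHELLS `y ↦ Σ_c ½ (y (idx c))²` (e.g. the energy that has crossed the bond
`0 | 1`, theory-1's half-transfer section) is an admissible section functional. [cite: Tao2016AveragedNS, §4 (4.6) (shell energies); cell certificate format, section functionals] -/
theorem continuousOn_energySec {N : ℕ} {idx : Fin N → Fin m × ℤ} (hidx : ∀ c, -Kb ≤ (idx c).2 ∧ (idx c).2 ≤ Ka)
    {s : ℝ} {S : Fin m → ℤ → ℝ → ℝ} (hrun : WindowRun 𝕊 ε₀ α Kb Ka Eb Et s S) :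
    ContinuousOn (fun u => (fun y : Fin m → ℤ → ℝ => ∑ c : Fin N, (1 / 2) * y (idx c).1 (idx c).2 ^ 2) (slice S u))
      (Icc 0 s) :=
  continuousOn_sec_of_continuous (F := fun v : Fin N → ℝ => ∑ c : Fin N, (1 / 2) * v c ^ 2) (by fun_prop) hidx
    (fun _ => rfl) hrun

end CertificateGlueOn

end Summit.NavierStokesRegularity.NavierStokesRegularity.Theorems

end
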